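/-
Copyright (c) 2026 the pub-hodgecm-mathlib formalisation cell (harness21).  Prover seat hodgecm-mathlib-F0P2-p08 (g0) (L1; LEAD F0P6-plan (g14) BATCH #52 (1) «F0P2-p08 → the KIND-W
INSTANCE at the TOP's carrier»; desk K2E5-p17 (g8) 2026-09-04T16:17:21Z «file∕head∕six conjuncts = tree `…TopNine.lean` :139–:147 bytes verbatim; split p08 = assembly +
`hRKW`∕holomorphy, K2E4-p10 (g8) = `(w hw0 hws hg)`»): Track B «K2-LIT», hLiu418 = stmt-HodgeConjecture-24832, road `K2_Liu`, socket #41, KIND W — EDITION 1, HYPOTHESIS-FIRST.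
-/
import Summits.HodgeConjecture.HodgeConjecture.Theorems.K2LiuSiegelEisensteinWhittakerMajorant      -- ★ p861512 (frame `HA`, `skewMatrices`, `gramR`, `whittakerDelta`, `adelicHeightGL`)
import Summits.HodgeConjecture.HodgeConjecture.Theorems.K2LiuGoodPlaceWhittakerEulerAssembly      -- ★ G2 `differentiableOn_inv_b`, `partialStandardL`, `quadraticHeckeCharCM`
import Summits.HodgeConjecture.HodgeConjecture.Theorems.K2LiuWhittakerWeightedGrowthInstance      -- ★ p862095 (K2E4-p10 (g8)) `exists_whittaker_factorLetters_weight` ((W3) at the factor letters) — ED. 2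
import HarnessLib

/-!
# Crux `HLiu418`, socket #41, KIND W — `exists_whittaker_factorLetters` (edition 1, hypothesis-first): the TOP's KIND-W package
# `∃ WT GW w, hWTd ∧ hGWd ∧ hw0 ∧ hws ∧ hg ∧ hRKW` from the EULER DATA `(A, U)` of rows G1∘G2 and the lattice-weighted growth of (W3)

Cell `hodgecm-mathlib`, crux item hLiu418 = `stmt-HodgeConjecture-24832`; squad K2 ∕ K2Liu (L1, LEAD F0P6-plan (g14)); prover F0P2-p08 (g0).  THEOREMS ONLY (no `def`,
no instance, no notation, no named-fact hypothesis, no `sorry`); lane `--supports stmt-HodgeConjecture-24832 --as helper`.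

THE INTERFACE (this edition pins it; later editions discharge the by-value letters).  For every non-degenerate Fourier index `S` and every `h ∈ H(𝔸)` rows G1 (★
`K2LiuWhittakerDeltaEulerProduct.whittakerDelta_eq_mul_tprod_euler`, Euler product of the Whittaker functional off a finite `T(S,h) ⊇ T₀(𝒦,f,χ) ∪ {v : h_v ∉ K_v}`), the per-place glue
★ `K2LiuGoodPlaceLocalFactor.integral_unipDeltaLoc_lambdaLoc_eq` (the spherical local factor at a good `S`-unimodular place is `(1 − q_v^{−(2s+1)})(1 − ε(ϖ_v)q_v^{−(2s+2)})`,
`ε = ε_{L∕L⁺} =` ★ `quadraticHeckeCharCM L`) and the face ★ `K2LiuGoodPlaceWhittakerEulerAssembly.tprod_whittaker_face_eq` give the EULER DATA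
  `W_S(f_s)(h) = A(S,s,h) · (b^{U(S,h)}(s))⁻¹`,  `b^U(s) = ζ^U_{L⁺}(2s+1)·L^U(2s+2, ε)` (★ `partialStandardL`),  `U(S,h) = D(S) ∪ T(S,h)`,
where `A(S,s,h)` = (the archimedean × `T(S,h)` joint Whittaker integral of the `T`-part of `f_s`) · ∏_{v ∈ D(S)∖T} W°_{S,v}(s) is HOLOMORPHIC on `{0 < re s}` ((W2): parametric integral +
★ Φ4∕Φ5 entire local coefficients).  THIS FILE takes `(A, U, hEuler, hAd)` ((W1)+(W2), this seat's later editions) and K2E4-p10 (g8)'s lattice-weighted growth `(w, hw0, hws, hg)`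
((W3), stated against the same `A`, `U`) BY VALUE and delivers the TOP's KIND-W package with
  **`WT := A`**, **`GW S s h := (b^{U(S,h)}(s))⁻¹`** — `hGWd` DISCHARGED BY NAME (★ G2 `differentiableOn_inv_b`: `b^U` holomorphic and zero-free on `{0 < re s}`, ★ O41.6
  `hasProd_b`∕`differentiableOn_b`, `ε_{L∕L⁺}` unitary ★ `isFiniteOrder_quadraticHeckeCharCM`), `hWTd := hAd`, `hRKW := hEuler`, `(hw0, hws, hg)` K2E4-p10's.
* `differentiableOn_GW` — `s ↦ (b^{U}(s))⁻¹` is holomorphic on `{0 < re s}` for every place set `U` (the `GW` conjunct, any frame);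
* **`exists_whittaker_factorLetters`** — the head, conjunct bytes = tree `Theorems/K2LiuSiegelEisensteinContinuationTopNine.lean` :140–:147 (= ★ ed. 8's binders `(WT GW) (hWTd) (hGWd)
  (w) (hw0) (hws) (hg) (hRKW)` as `∃ …, … ∧ …`), frame-generic (`e : Fin N × Fin M ≃ Fin n`; the TOP reads `N = 2`, `M = 1`), carrier-generic (`νN` any measure on `N_Δ(𝔸)`).
[KudlaRallis1994, §1–§2]; [Tan1999, §2–§3, §4 Prop. 4.8]; [Shimura1997, §18.3–18.5]; [Liu2011, §2A (2-10)]; [NeukirchANT1999, Ch. VII §8].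
HONEST LABEL.  Count-neutral helper; hypothesis-first (the letters `hEuler`, `hAd`, `hg`∕`hws` are by value until (W1)∕(W2)∕(W3) land): `HC_CM` is proved only modulo the 7 printed
citations (2 remaining named inputs: hLiu418 = `stmt-HodgeConjecture-24832`, h413 = `stmt-HodgeConjecture-24833`) until rung 0 closes; this file closes no socket.
-/

set_option autoImplicit false
set_option linter.dupNamespace false -- the mandated namespace repeats `HodgeConjecture.HodgeConjecture`

noncomputable section

open scoped Matrix ENNReal NNReal
open NumberField IsDedekindDomain MeasureTheory
open Literature.NumberTheory.Automorphic Literature.NumberTheory.GaloisRepresentations Literature.NumberTheory.LFunctions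
open Literature.NumberTheory.GelbartRogawski1991 Literature.NumberTheory.GelbartRogawski1991.GRConstruction
open Literature.NumberTheory.K2Lit.SiegelDoubled

namespace Summit.HodgeConjecture.HodgeConjecture.Cruxes.HLiu418.K2LiuSiegelEisensteinWhittakerFactorLetters

open K2LiuSiegelUnipotentFourierDefs
open K2LiuGoodPlaceWhittakerEulerAssembly (differentiableOn_inv_b)

/-- **THE `GW` CONJUNCT**: for every set of finite places `U` of `L⁺`, `s ↦ (b^U(s))⁻¹ = (ζ^U_{L⁺}(2s+1)·L^U(2s+2, ε_{L∕L⁺}))⁻¹` is holomorphic on `{0 < re s}` (★ G2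
`differentiableOn_inv_b` at the unitary `ε_{L∕L⁺}`, ★ `isFiniteOrder_quadraticHeckeCharCM`). [cite: NeukirchANT1999, Ch. VII §8] [cite: KudlaRallis1994, §1] -/
theorem differentiableOn_GW (L : Type) [Field L] [NumberField L] [IsCMField L] (U : Set (HeightOneSpectrum (𝓞 ↥(maximalRealSubfield L)))) :
    DifferentiableOn ℂ (fun s : ℂ =>
      (partialStandardL U (fun _ => {1}) (2 * s + 1) * partialStandardL U (fun v => {(quadraticHeckeCharCM L).valueAtUniformizer v}) (2 * s + 2))⁻¹)
      {s : ℂ | 0 < s.re} :=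
  differentiableOn_inv_b (Literature.RepresentationTheory.HarrisKudlaSweet1996.isFiniteOrder_quadraticHeckeCharCM (L := L)).isUnitary

/-- **SOCKET #41, KIND W — THE FACTOR LETTERS (edition 1, hypothesis-first).**  From the EULER DATA `(A, U)` of rows G1∘G2 — `W_S(f_s)(h) = A S s h · (b^{U S h}(s))⁻¹` on
`{n∕2 < re s}` for `det S ≠ 0` (`hEuler`, (W1)), `A S · h` holomorphic on `{0 < re s}` (`hAd`, (W2)) — and the lattice-weighted growth of the product with a summable weight
(`w hw0 hws hg`, (W3), K2E4-p10 (g8)): the TOP's KIND-W package with `WT := A`, `GW S s h := (b^{U S h}(s))⁻¹` (`hGWd` by `differentiableOn_GW`).  Conjunct bytes = ★ ed. 9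
`siegelEisensteinContinuation_nine`'s `hW`. [cite: KudlaRallis1994, §1–§2] [cite: Tan1999, §2–§3, §4 Prop. 4.8] [cite: Shimura1997, §18.3–18.5] [cite: Liu2011, §2A (2-10)] -/
theorem exists_whittaker_factorLetters
    (L : Type) [Field L] [NumberField L] [IsCMField L] {N M n : ℕ} (e : Fin N × Fin M ≃ Fin n)
    (dV : Fin N → L) (hdV : ∀ i, IsCMField.complexConj L (dV i) = dV i)
    (dW : Fin M → L) (hdW : ∀ i, IsCMField.complexConj L (dW i) = dW i)
    (f : ℂ → HA L e dV hdV dW hdW → ℂ)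
    [MeasurableSpace (unipDelta L e dV hdV dW hdW)] (νN : Measure (unipDelta L e dV hdV dW hdW))
    -- (W1) the EULER DATA by value: `T`-part `A` and exceptional place set `U(S,h) = D(S) ∪ T(S,h)`, with the Euler identity on `{n∕2 < re s}`
    (A : skewMatrices ((IsCMField.complexConj L : L ≃ₐ[Fp L] L) : L →+* L) ((gramR L e dV hdV dW hdW).map (algebraMap (Fp L) L)) → ℂ → HA L e dV hdV dW hdW → ℂ)
    (U : skewMatrices ((IsCMField.complexConj L : L ≃ₐ[Fp L] L) : L →+* L) ((gramR L e dV hdV dW hdW).map (algebraMap (Fp L) L)) → HA L e dV hdV dW hdW →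
      Set (HeightOneSpectrum (𝓞 ↥(maximalRealSubfield L))))
    (hEuler : ∀ S : skewMatrices ((IsCMField.complexConj L : L ≃ₐ[Fp L] L) : L →+* L) ((gramR L e dV hdV dW hdW).map (algebraMap (Fp L) L)),
      (S : Matrix (Fin n) (Fin n) L).det ≠ 0 → ∀ (s : ℂ) (h : HA L e dV hdV dW hdW), (n : ℝ) / 2 < s.re →
        whittakerDelta L e dV hdV dW hdW νN (S : Matrix (Fin n) (Fin n) L) (f s) h =
          A S s h * (partialStandardL (U S h) (fun _ => {1}) (2 * s + 1) *
            partialStandardL (U S h) (fun v => {(quadraticHeckeCharCM L).valueAtUniformizer v}) (2 * s + 2))⁻¹)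
    -- (W2) holomorphy of the `T`-part
    (hAd : ∀ S (h : HA L e dV hdV dW hdW), DifferentiableOn ℂ (fun s => A S s h) {s : ℂ | 0 < s.re})
    -- (W3) the lattice-weighted growth of the product with a summable weight (K2E4-p10 (g8))
    (w : skewMatrices ((IsCMField.complexConj L : L ≃ₐ[Fp L] L) : L →+* L) ((gramR L e dV hdV dW hdW).map (algebraMap (Fp L) L)) → ℝ) (hw0 : ∀ S, 0 ≤ w S) (hws : Summable w)
    (hg : ∀ z : ℂ, 0 < z.re → ∃ C A' r : ℝ, 0 ≤ C ∧ 0 ≤ A' ∧ 0 < r ∧ ∀ S (s : ℂ), dist s z < r → ∀ h : HA L e dV hdV dW hdW,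
      ‖A S s h * (partialStandardL (U S h) (fun _ => {1}) (2 * s + 1) *
          partialStandardL (U S h) (fun v => {(quadraticHeckeCharCM L).valueAtUniformizer v}) (2 * s + 2))⁻¹‖ ≤
        C * w S * adelicHeightGL (n + n) L (h : GL (Fin (n + n)) (AdeleRing (𝓞 L) L)) ^ A') :
    ∃ (WT GW : skewMatrices ((IsCMField.complexConj L : L ≃ₐ[Fp L] L) : L →+* L) ((gramR L e dV hdV dW hdW).map (algebraMap (Fp L) L)) → ℂ → HA L e dV hdV dW hdW → ℂ) (w : skewMatrices ((IsCMField.complexConj L : L ≃ₐ[Fp L] L) : L →+* L) ((gramR L e dV hdV dW hdW).map (algebraMap (Fp L) L)) → ℝ),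
        (∀ S (h : HA L e dV hdV dW hdW), DifferentiableOn ℂ (fun s => WT S s h) {s : ℂ | 0 < s.re}) ∧
        (∀ S (h : HA L e dV hdV dW hdW), DifferentiableOn ℂ (fun s => GW S s h) {s : ℂ | 0 < s.re}) ∧
        (∀ S, 0 ≤ w S) ∧
        (Summable w) ∧
        (∀ z : ℂ, 0 < z.re → ∃ C A r : ℝ, 0 ≤ C ∧ 0 ≤ A ∧ 0 < r ∧ ∀ S (s : ℂ), dist s z < r → ∀ h : HA L e dV hdV dW hdW,
      ‖WT S s h * GW S s h‖ ≤ C * w S * adelicHeightGL (n + n) L (h : GL (Fin (n + n)) (AdeleRing (𝓞 L) L)) ^ A) ∧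
        (∀ S : skewMatrices ((IsCMField.complexConj L : L ≃ₐ[Fp L] L) : L →+* L) ((gramR L e dV hdV dW hdW).map (algebraMap (Fp L) L)),
      (S : Matrix (Fin n) (Fin n) L).det ≠ 0 → ∀ (s : ℂ) (h : HA L e dV hdV dW hdW), (n : ℝ) / 2 < s.re →
        whittakerDelta L e dV hdV dW hdW νN (S : Matrix (Fin n) (Fin n) L) (f s) h = WT S s h * GW S s h) :=
  ⟨A, fun S s h => (partialStandardL (U S h) (fun _ => {1}) (2 * s + 1) *
      partialStandardL (U S h) (fun v => {(quadraticHeckeCharCM L).valueAtUniformizer v}) (2 * s + 2))⁻¹, w,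
    hAd, fun S h => differentiableOn_GW L (U S h), hw0, hws, hg, hEuler⟩

/-! ## Edition 2 (append-only): (W3) DISCHARGED BY NAME — K2E4-p10 (g8)'s ★ `exists_whittaker_factorLetters_weight` composed in -/

open scoped Classical in -- `Fintype {w // IsReal w}` etc. inside `mixedSpace L` (as in ★ p862095's statement of `hτ`)
/-- **SOCKET #41, KIND W — THE FACTOR LETTERS, EDITION 2: the weight `(w, hw0, hws, hg)` OBTAINED from ★ `K2LiuWhittakerWeightedGrowthInstance.exists_whittaker_factorLetters_weight`**
(K2E4-p10 (g8)): the TOP's KIND-W package from the Euler data `(A, U, hEuler, hAd)` ((W1)+(W2), by value) and THREE letters on `A` alone — the size comparison `hτ`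
(`τ S ≥` the sup-norm of the mixed embedding of the entries of `S`), (L-dec) `hdec` (archimedean Gaussian decay in height form, rows G4 × G7) and (L-supp) `hsupp`
(bounded-denominator support on `{0 < re s}`, row G3 × finite height); needs `0 < n`.  The TOP's KIND-W by-value surface becomes `(A U hEuler hAd τ hτ N₀ hdec hC₀ hκ hsupp)`.
[cite: KudlaRallis1994, §1–§2] [cite: Tan1999, §2–§3, §4 Prop. 4.8] [cite: Shimura1997, §18.4, Prop. 18.14] [cite: MoeglinWaldspurger1995, IV.1.9] -/
theorem exists_whittaker_factorLetters_of_weightLetters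
    (L : Type) [Field L] [NumberField L] [IsCMField L] {N M n : ℕ} (hn : 0 < n) (e : Fin N × Fin M ≃ Fin n)
    (dV : Fin N → L) (hdV : ∀ i, IsCMField.complexConj L (dV i) = dV i)
    (dW : Fin M → L) (hdW : ∀ i, IsCMField.complexConj L (dW i) = dW i)
    (f : ℂ → HA L e dV hdV dW hdW → ℂ)
    [MeasurableSpace (unipDelta L e dV hdV dW hdW)] (νN : Measure (unipDelta L e dV hdV dW hdW))
    -- (W1) the EULER DATA by value
    (A : skewMatrices ((IsCMField.complexConj L : L ≃ₐ[Fp L] L) : L →+* L) ((gramR L e dV hdV dW hdW).map (algebraMap (Fp L) L)) → ℂ → HA L e dV hdV dW hdW → ℂ)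
    (U : skewMatrices ((IsCMField.complexConj L : L ≃ₐ[Fp L] L) : L →+* L) ((gramR L e dV hdV dW hdW).map (algebraMap (Fp L) L)) → HA L e dV hdV dW hdW →
      Set (HeightOneSpectrum (𝓞 ↥(maximalRealSubfield L))))
    (hEuler : ∀ S : skewMatrices ((IsCMField.complexConj L : L ≃ₐ[Fp L] L) : L →+* L) ((gramR L e dV hdV dW hdW).map (algebraMap (Fp L) L)),
      (S : Matrix (Fin n) (Fin n) L).det ≠ 0 → ∀ (s : ℂ) (h : HA L e dV hdV dW hdW), (n : ℝ) / 2 < s.re →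
        whittakerDelta L e dV hdV dW hdW νN (S : Matrix (Fin n) (Fin n) L) (f s) h =
          A S s h * (partialStandardL (U S h) (fun _ => {1}) (2 * s + 1) *
            partialStandardL (U S h) (fun v => {(quadraticHeckeCharCM L).valueAtUniformizer v}) (2 * s + 2))⁻¹)
    -- (W2) holomorphy of the `T`-part
    (hAd : ∀ S (h : HA L e dV hdV dW hdW), DifferentiableOn ℂ (fun s => A S s h) {s : ℂ | 0 < s.re})
    -- (W3) K2E4-p10 (g8)'s three letters on `A`
    (τ : skewMatrices ((IsCMField.complexConj L : L ≃ₐ[Fp L] L) : L →+* L) ((gramR L e dV hdV dW hdW).map (algebraMap (Fp L) L)) → ℝ)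
    (hτ : ∀ S : skewMatrices ((IsCMField.complexConj L : L ≃ₐ[Fp L] L) : L →+* L) ((gramR L e dV hdV dW hdW).map (algebraMap (Fp L) L)),
      ‖(fun i j => NumberField.mixedEmbedding L ((S : Matrix (Fin n) (Fin n) L) i j))‖ ≤ τ S) (N₀ : ℕ)
    (hdec : ∀ z : ℂ, 0 < z.re → ∃ C a c a' r : ℝ, 0 ≤ C ∧ 0 ≤ a ∧ 0 < c ∧ 0 ≤ a' ∧ 0 < r ∧ ∀ S (s : ℂ), dist s z < r → ∀ h : HA L e dV hdV dW hdW,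
      ‖A S s h‖ ≤ C * adelicHeightGL (n + n) L (h : GL (Fin (n + n)) (AdeleRing (𝓞 L) L)) ^ a *
        (Real.exp (-(c * adelicHeightGL (n + n) L (h : GL (Fin (n + n)) (AdeleRing (𝓞 L) L)) ^ (-a') * τ S)) * (1 + τ S) ^ N₀))
    {C₀ κ : ℝ} (hC₀ : 0 < C₀) (hκ : 0 ≤ κ)
    (hsupp : ∀ S (s : ℂ) (h : HA L e dV hdV dW hdW), 0 < s.re → A S s h ≠ 0 →
      ∃ D : ℕ, 1 ≤ D ∧ (D : ℝ) ≤ C₀ * adelicHeightGL (n + n) L (h : GL (Fin (n + n)) (AdeleRing (𝓞 L) L)) ^ κ ∧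
        ∀ i j, IsIntegral ℤ ((D : L) * (S : Matrix (Fin n) (Fin n) L) i j)) :
    ∃ (WT GW : skewMatrices ((IsCMField.complexConj L : L ≃ₐ[Fp L] L) : L →+* L) ((gramR L e dV hdV dW hdW).map (algebraMap (Fp L) L)) → ℂ → HA L e dV hdV dW hdW → ℂ) (w : skewMatrices ((IsCMField.complexConj L : L ≃ₐ[Fp L] L) : L →+* L) ((gramR L e dV hdV dW hdW).map (algebraMap (Fp L) L)) → ℝ),
        (∀ S (h : HA L e dV hdV dW hdW), DifferentiableOn ℂ (fun s => WT S s h) {s : ℂ | 0 < s.re}) ∧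
        (∀ S (h : HA L e dV hdV dW hdW), DifferentiableOn ℂ (fun s => GW S s h) {s : ℂ | 0 < s.re}) ∧
        (∀ S, 0 ≤ w S) ∧
        (Summable w) ∧
        (∀ z : ℂ, 0 < z.re → ∃ C A r : ℝ, 0 ≤ C ∧ 0 ≤ A ∧ 0 < r ∧ ∀ S (s : ℂ), dist s z < r → ∀ h : HA L e dV hdV dW hdW,
      ‖WT S s h * GW S s h‖ ≤ C * w S * adelicHeightGL (n + n) L (h : GL (Fin (n + n)) (AdeleRing (𝓞 L) L)) ^ A) ∧
        (∀ S : skewMatrices ((IsCMField.complexConj L : L ≃ₐ[Fp L] L) : L →+* L) ((gramR L e dV hdV dW hdW).map (algebraMap (Fp L) L)),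
      (S : Matrix (Fin n) (Fin n) L).det ≠ 0 → ∀ (s : ℂ) (h : HA L e dV hdV dW hdW), (n : ℝ) / 2 < s.re →
        whittakerDelta L e dV hdV dW hdW νN (S : Matrix (Fin n) (Fin n) L) (f s) h = WT S s h * GW S s h) := by
  obtain ⟨w, hw0, hws, hg⟩ :=
    K2LiuWhittakerWeightedGrowthInstance.exists_whittaker_factorLetters_weight L hn e dV hdV dW hdW A U τ hτ N₀ hdec hC₀ hκ hsupp
  exact exists_whittaker_factorLetters L e dV hdV dW hdW f νN A U hEuler hAd w hw0 hws hg

end Summit.HodgeConjecture.HodgeConjecture.Cruxes.HLiu418.K2LiuSiegelEisensteinWhittakerFactorLetters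

end
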